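import Mathlib.Analysis.SpecialFunctions.Pow.Real
import Literature.Probability.LatticeModels.IsoradialPercolation
import Literature.Probability.Percolation.Percolation
import HarnessLib

/-!
# Near-minimum cuts in network reliability: Karger's cut counting and failure bound, Lomonosov–Polesskii's cycle comparison

Topic `Literature/Probability/Percolation` (bond percolation on a finite multigraph = the
"all-terminal network reliability" model: every edge fails independently). Source: D. R. Karger,
*A randomized fully polynomial time approximation scheme for the all-terminal network reliability
problem*, SIAM J. Comput. **29** (1999) 492–514 [Karger1999] (read: `lit read paper:arxiv-cs_9809012`,
§2.2 Def. 2.2 / Thm. 2.6 and §2.3 Thm. 2.9); the counting theorem in `O`-form is D. R. Karger,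
C. Stein, *A new approach to the minimum cut problem*, J. ACM **43** (1996) 601–640 [KargerStein1996],
§8 Def. 8.1, Thm. 8.4 (pp. 630–631). The cycle comparison is M. V. Lomonosov, V. P. Polesskii, *Lower bound
of network reliability*, Probl. Inf. Transm. **8** (1972) 118–123 [LomonosovPolesskii1972] (not held; cited
after Karger 1999, §4.3.2 Lemma 4.7 / Cor. 4.8, who re-proves it, and Colbourn 1988 [Colbourn1988] ref. [15]).

## Printed statements

Setting (Karger 1999, §2, pp. 4–5 of the arXiv version): an undirected multigraph on `n` vertices ("graphs
with parallel edges between the same endpoints; the theorem follows for weighted graphs if we replace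
any weight `w` edge by a set of `w` unweighted parallel edges"); "By a *cut* we mean a partition of the
graph vertices into two groups. The cut edges are those with one endpoint in each group … The *value*
of the cut is the number of edges crossing the cut"; "we assume that our graph has minimum cut value
`c` — that is, that the smallest cut in the graph has exactly `c` edges"; each edge fails (is deleted)
independently with probability `p`, and a cut *fails* when all of its edges fail ("a graph becomes
disconnected precisely when all of the edges in some cut of the graph fail").

* **Definition 2.2.** "An `α`-minimum cut is a cut with value at most `α` times the minimum cut value."
* **Theorem 2.6** (cut counting). "An undirected graph has less than `n^{2α}` `α`-minimum cuts."
  (Proof: random contraction to `⌈2α⌉` vertices; the cycle shows the order is tight. Karger–Stein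
  Thm. 8.4: "In any graph, the number of `α`-minimal cuts is `O((2n)^{2α})`.")
* **Theorem 2.9** (large cuts rarely fail). "Suppose a graph has minimum cut `c` and that each edge of
  the graph fails independently with probability `p`, where `p^c = n^{-(2+δ)}` for some `δ > 0`. Then
  (i) the probability that the given graph disconnects is at most `n^{-δ}(1 + 2/δ)`, and (ii) the
  probability that a cut of value `αc` or greater fails in the graph is at most `n^{-αδ}(1 + 2/δ)`."
  (Remark there: (i) was "first proved, in a slightly stronger version, by Lomonosov and Polesskii";
  (ii) is the union bound over cuts fed with Thm. 2.6.)
* **Lemma 4.7** (Lomonosov–Polesskii; Karger's §4.3.2 "A better argument … via a small variation on an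
  argument due to Lomonosov and Polesskii"). "Let `fail_r(G,p)` denote the probability that `G` partitions
  into `r` or more connected components when each edge fails with probability `p`. Let `G` have minimum
  cut `c` for some even `c`. Let `C_n` be a cycle with `c/2` edges between adjacent vertices. Then for any
  `r`, `fail_r(G,p) ≤ fail_r(C_n,p)`."  **Corollary 4.8.** "For any graph `G` with minimum cut `c`, if
  edges fail with probability `p` where `p^c = n^{-(2+δ)}`, then the probability the failed graph has `r`
  or more connected components is less than `n^{-δr/2}`."  (`C_n` has the same number `n` of vertices as
  `G`; proof by stochastic domination of the contraction times `T_r(G) ≤_{st} T_r(C_n)`.)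

## Transcription (the tree's vocabulary)

A multigraph on `n` vertices is a multiplicity function `m : Sym2 (Fin n) → ℕ` (the diagonal is never
read). A cut is a vertex set `S : Finset (Fin n)` with `S` and `Sᶜ` nonempty; its value
`multigraphCutValue m S = ∑_{x ∈ S} ∑_{y ∉ S} m s(x,y)` counts each crossing edge once. The unordered
cut `{S, Sᶜ}` is counted ONCE by anchoring a vertex `v ∈ S` (exactly one side contains `v`). "Minimum cut
`c`" is transcribed literally: `c` is a lower bound of all cut values AND is attained (for Thm. 2.6 only the
lower bound is used: cuts of value `≤ αc` with `c ≤ min cut` are `α`-minimum, so the anchored form below is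
implied by — and for `c = min cut` is — the printed statement). The independent failure of the `m e`
parallel copies of `e`, each with probability `p`, is — for every connectivity event — the same as ONE
edge `e` being open with probability `1 − p^{m e}`: the configuration law is the tree's
`prodBernoulli (bundleOpenWeight m p)` on `Set (Sym2 (Fin n))`, and "the cut `S` fails" is the event
`cutFails S = {ω | no ω-edge joins S to Sᶜ}`. The exponents `2α`, `-δ`, `-αδ` are real powers (`Real.rpow`).
"`G` partitions into `r` or more connected components" is `r ≤ Nat.card (openGraph ω).ConnectedComponent`
(the tree's open graph `openGraph ω = fromEdgeSet ω` on ALL `n` vertices), and the bundled cycle `C_n`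
with `k = c/2` parallel edges between cyclically adjacent vertices is the multiplicity function
`cycleBundle n k` (for `n = 2` the two bundles of `C_2` are parallel, multiplicity `2k = c`, as in the source).

## Contents

* `multigraphCutValue`, `bundleOpenWeight`, `cutFails` — definitions (with unfolding lemmas).
* `Karger1999_cutCounting` — NAMED FACT, Thm. 2.6 (for real `α ≥ 1`).
* `Karger1999_largeCutFailure` — NAMED FACT, Thm. 2.9 (i) and (ii) (for real `α ≥ 1`).
* `cycleBundle` — definition; `LomonosovPolesskii1972_cycleComparison` — NAMED FACT, Lemma 4.7 as printed
  by Karger (the cycle with `c/2`-fold edges maximises `P(≥ r components)` among `n`-vertex multigraphs of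
  even minimum cut `c`, for every `p` and `r`).

All three facts were checked by exhaustive enumeration on random multigraphs with `n ≤ 7`
(vendoring session, `scratch/karger_check.py`: 1736 + 3444 instances; `scratch/lp_check.py`: 1855
instances `n ≤ 6`; no violation). Deliberately NOT here: the FPRAS (Thms. 2.10, 3.1, Lemma 3.2 —
algorithmic), the `r`-way cut counting (§4.1), Cor. 4.8 (a computation on top of Lemma 4.7), and the
Lomonosov–Polesskii 1971 noncrossing-cuts UPPER bound on reliability (a different result).

## Discharge notes (for the debt queue; sizes are estimates)

* `Karger1999_cutCounting` (L): the printed proof is an averaging argument over runs of the random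
  Contraction Algorithm stopped at `k = ⌈2α⌉` vertices followed by a uniform random 2-colouring
  (Karger 1999 §2.2.3; Karger–Stein Thm. 8.2–8.4): every fixed `α`-minimum cut is output with
  probability `≥ C(k,2α)/C(n,2α) · 2^{1-k} > n^{-2α}` (generalised binomials), and these events are
  disjoint. A Lean route: double counting over (edge orderings × colourings) with exchangeability, or
  the equivalent statement for random edge permutations of the multigraph.
* `Karger1999_largeCutFailure` (M given cut counting): `P(cut S fails) = p^{value S}` (product structure
  of `prodBernoulli`), union bound, cuts sorted by value `c₁ ≤ c₂ ≤ …`; the first `n²` terms give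
  `≤ n² p^c = n^{-δ}`, and cut counting gives `c_k > (ln k / 2 ln n)·c` for `k > n^{2α}`, so the tail is
  `< Σ_{k>n²} k^{-(1+δ/2)} ≤ 2n^{-δ}/δ` (Karger 1999, proof of Thm. 2.9; Harris–Srinivasan 2018 Prop. 2.2
  is the Abel-summation form).
* `LomonosovPolesskii1972_cycleComparison` (L): exponential clocks on edges, contraction times
  `T_r = Σ_{r'≥r} t_{r'}` with `t_r(G)` exponential of rate `m_r ≥ cr/2` (every super-vertex of a
  `c`-edge-connected multigraph has degree `≥ c`) versus rate exactly `cr/2` for the bundled cycle;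
  stochastic domination of independent sums (Karger 1999, proof of Lemma 4.7).
-/

noncomputable section

open Finset
open Literature.Probability.LatticeModels (prodBernoulli)

namespace Literature.Probability.Percolation

/-- The value of the cut `(S, Sᶜ)` in the multigraph with edge multiplicities `m`: the number of edges
with exactly one endpoint in `S`, each crossing edge `s(x,y)` (`x ∈ S`, `y ∉ S`) counted once.
(Karger 1999, §2: "The value of the cut is the number of edges crossing the cut".)
[cite: Karger1999, §2 (cuts and their value)] -/
def multigraphCutValue {n : ℕ} (m : Sym2 (Fin n) → ℕ) (S : Finset (Fin n)) : ℕ :=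
  ∑ x ∈ S, ∑ y ∈ Sᶜ, m s(x, y)

/-- Unfolding lemma for `multigraphCutValue`. [cite: Karger1999, §2 (cuts and their value)] -/
theorem multigraphCutValue_def {n : ℕ} (m : Sym2 (Fin n) → ℕ) (S : Finset (Fin n)) :
    multigraphCutValue m S = ∑ x ∈ S, ∑ y ∈ Sᶜ, m s(x, y) := rfl

/-- The two sides of a cut have the same value: `value(Sᶜ) = value(S)`. [folklore] -/
theorem multigraphCutValue_compl {n : ℕ} (m : Sym2 (Fin n) → ℕ) (S : Finset (Fin n)) :
    multigraphCutValue m Sᶜ = multigraphCutValue m S := by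
  unfold multigraphCutValue
  rw [compl_compl, Finset.sum_comm]
  refine Finset.sum_congr rfl fun x _ => Finset.sum_congr rfl fun y _ => ?_
  rw [Sym2.eq_swap]

/-- The bundle model of independent parallel-edge failures: if each of the `m e` parallel copies of `e`
fails independently with probability `p`, the bundle `e` carries an open edge with probability
`1 − p^{m e}` (and a pair of multiplicity `0` is never open). (Karger 1999, §2.2: "the theorem follows
for weighted graphs if we replace any weight `w` edge by a set of `w` unweighted parallel edges".)
[cite: Karger1999, §2.2 (parallel edges)] -/
def bundleOpenWeight {n : ℕ} (m : Sym2 (Fin n) → ℕ) (p : unitInterval) :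
    Sym2 (Fin n) → unitInterval :=
  fun e => unitInterval.symm (p ^ (m e))

/-- The open-probability of the bundle `e` is `1 − p^{m e}`. [cite: Karger1999, §2.2 (parallel edges)] -/
theorem coe_bundleOpenWeight {n : ℕ} (m : Sym2 (Fin n) → ℕ) (p : unitInterval) (e : Sym2 (Fin n)) :
    (bundleOpenWeight m p e : ℝ) = 1 - (p : ℝ) ^ (m e) := by
  simp [bundleOpenWeight]

/-- The event "the cut `(S, Sᶜ)` fails": no open edge joins `S` to its complement (Karger 1999, §2:
"a graph becomes disconnected precisely when all of the edges in some cut of the graph fail").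
[cite: Karger1999, §2 (cut failure)] -/
def cutFails {n : ℕ} (S : Finset (Fin n)) : Set (Set (Sym2 (Fin n))) :=
  {ω | ∀ x ∈ S, ∀ y ∈ Sᶜ, s(x, y) ∉ ω}

/-- Membership in `cutFails`. [cite: Karger1999, §2 (cut failure)] -/
theorem mem_cutFails_iff {n : ℕ} (S : Finset (Fin n)) (ω : Set (Sym2 (Fin n))) :
    ω ∈ cutFails S ↔ ∀ x ∈ S, ∀ y ∈ Sᶜ, s(x, y) ∉ ω := Iff.rfl

/-- **Karger's cut-counting theorem** (Karger 1999, Thm. 2.6; Karger–Stein 1996, Thm. 8.4): in a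
multigraph on `n` vertices whose cuts all have value at least `c > 0`, for every real `α ≥ 1` the number
of cuts of value at most `αc` is less than `n^{2α}`. Cuts `{S, Sᶜ}` are counted once, through the side
containing the anchor vertex `v`. With `c` = the minimum cut value this is verbatim "an undirected graph
has less than `n^{2α}` `α`-minimum cuts"; for a smaller lower bound `c` the counted family only shrinks.
[cite: Karger1999, Thm. 2.6] -/
def Karger1999_cutCounting : Prop :=
  ∀ (n : ℕ) (m : Sym2 (Fin n) → ℕ) (v : Fin n) (c α : ℝ), 0 < c → 1 ≤ α →
    (∀ S : Finset (Fin n), S.Nonempty → Sᶜ.Nonempty → c ≤ (multigraphCutValue m S : ℝ)) →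
    ((Finset.univ.filter fun S : Finset (Fin n) =>
        v ∈ S ∧ Sᶜ.Nonempty ∧ (multigraphCutValue m S : ℝ) ≤ α * c).card : ℝ) < (n : ℝ) ^ (2 * α)

/-- **Large cuts rarely fail** (Karger 1999, Thm. 2.9). A multigraph on `n` vertices with minimum cut
exactly `c ≥ 1` (every cut has value `≥ c`, some cut has value `c`); every parallel edge fails
independently with probability `p ∈ (0,1)`, where `p^c = n^{-(2+δ)}` with `δ > 0` (bundle model
`prodBernoulli (bundleOpenWeight m p)`). Then (i) `P(some cut fails) ≤ n^{-δ}(1 + 2/δ)` and (ii) for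
every real `α ≥ 1`, `P(some cut of value ≥ αc fails) ≤ n^{-αδ}(1 + 2/δ)`.
[cite: Karger1999, Thm. 2.9] -/
def Karger1999_largeCutFailure : Prop :=
  ∀ (n : ℕ) (m : Sym2 (Fin n) → ℕ) (c : ℕ) (p : unitInterval) (δ α : ℝ),
    1 ≤ c → 0 < δ → 1 ≤ α → 0 < (p : ℝ) → (p : ℝ) < 1 →
    (∀ S : Finset (Fin n), S.Nonempty → Sᶜ.Nonempty → c ≤ multigraphCutValue m S) →
    (∃ S : Finset (Fin n), S.Nonempty ∧ Sᶜ.Nonempty ∧ multigraphCutValue m S = c) →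
    (p : ℝ) ^ c = (n : ℝ) ^ (-(2 + δ)) →
    (prodBernoulli (bundleOpenWeight m p)).real
        {ω | ∃ S : Finset (Fin n), S.Nonempty ∧ Sᶜ.Nonempty ∧ ω ∈ cutFails S}
        ≤ (n : ℝ) ^ (-δ) * (1 + 2 / δ) ∧
    (prodBernoulli (bundleOpenWeight m p)).real
        {ω | ∃ S : Finset (Fin n), S.Nonempty ∧ Sᶜ.Nonempty ∧
            α * c ≤ (multigraphCutValue m S : ℝ) ∧ ω ∈ cutFails S}
        ≤ (n : ℝ) ^ (-(α * δ)) * (1 + 2 / δ)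

/-- The bundled cycle `C_n^{(k)}`: multiplicity `k` between cyclically adjacent vertices `i`, `i+1 (mod n)`
of `Fin n`, `0` otherwise; written as `k·([j ≡ i+1] + [i ≡ j+1])` so that for `n = 2` the two parallel
bundles of the 2-cycle merge into one pair of multiplicity `2k` (Karger 1999, Lemma 4.7: "a cycle with
`c/2` edges between adjacent vertices"; the diagonal is never read). [cite: Karger1999, Lemma 4.7] -/
def cycleBundle (n k : ℕ) : Sym2 (Fin n) → ℕ :=
  Sym2.lift ⟨fun i j => k * ((if j.val = (i.val + 1) % n then 1 else 0) +
      (if i.val = (j.val + 1) % n then 1 else 0)), fun i j => by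
    show k * _ = k * _; rw [add_comm]⟩

/-- Unfolding lemma for `cycleBundle` on a pair. [cite: Karger1999, Lemma 4.7] -/
theorem cycleBundle_mk (n k : ℕ) (i j : Fin n) :
    cycleBundle n k s(i, j) = k * ((if j.val = (i.val + 1) % n then 1 else 0) +
      (if i.val = (j.val + 1) % n then 1 else 0)) := rfl

/-- **Lomonosov–Polesskii cycle comparison** (Lomonosov–Polesskii 1972; in the form printed and re-proved
as Karger 1999, Lemma 4.7): among multigraphs on `n` vertices with minimum cut exactly `c`, `c` even, the
cycle `C_n` with `c/2` parallel edges between adjacent vertices maximises, for EVERY edge-failure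
probability `p` and every `r`, the probability of falling into `r` or more connected components:
`fail_r(G,p) ≤ fail_r(C_n,p)` (bundle model `prodBernoulli (bundleOpenWeight · p)`; components of the
open graph on all `n` vertices). [cite: Karger1999, Lemma 4.7] -/
def LomonosovPolesskii1972_cycleComparison : Prop :=
  ∀ (n : ℕ) (m : Sym2 (Fin n) → ℕ) (c : ℕ) (p : unitInterval) (r : ℕ), Even c →
    (∀ S : Finset (Fin n), S.Nonempty → Sᶜ.Nonempty → c ≤ multigraphCutValue m S) →
    (∃ S : Finset (Fin n), S.Nonempty ∧ Sᶜ.Nonempty ∧ multigraphCutValue m S = c) →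
    (prodBernoulli (bundleOpenWeight m p)).real
        {ω | r ≤ Nat.card (openGraph ω).ConnectedComponent}
      ≤ (prodBernoulli (bundleOpenWeight (cycleBundle n (c / 2)) p)).real
        {ω | r ≤ Nat.card (openGraph ω).ConnectedComponent}

end Literature.Probability.Percolation

end
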